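import Summits.RiemannHypothesis.RiemannHypothesis.Theorems.WeilFormatCCinfGramHankel
import HarnessLib

/-!
# Format C, design C∞: the Hankel family-Gram majorant for the ODD sector (kernel index `m` ↔ mode `m+1`)

Route context: Fourier–Galerkin / Schur-complement certificates of Weil positivity on a window ("format C", C∞ door;
cell memo `run/shared/lean/pub/rh-explicit/rh-explicit-weil-10/KERNEL-LEVER.md` §22; supporting stmt-RiemannHypothesis-0098;
seat rh-explicit-weil-10).  `cinf_sum_Ico_sq_le_of_hankel_boxes` (`WeilFormatCCinfGramHankel`, weil-2) is the `hΓe`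
hypothesis of the C∞ front door for the rescaled families `T_t(m)·(m₀/m)^{e+1}` summed over the MODES `m ∈ [m₀, N)`.
The odd sector of `weilPositivityOn_of_cinf_poly` / `_matrix` / `_cert` is indexed by KERNEL indices: its families live at
the mode `m+1` with threshold `m₀+1` (the collected odd rows / images / tables are instantiated at `(m := m+1)`), and
`hΓo` sums `Σ_{m ∈ [m₀, N)} (Σ_y u_y φ_y(m))²` over kernel indices.  This file is the one-line reindexing
`Σ_{m∈[m₀,N)} F(m+1) = Σ_{m'∈[m₀+1,N+1)} F(m')`:

* `cinf_sum_Ico_sq_le_of_hankel_boxes_succ` — LITERALLY the `hΓo` hypothesis for the odd rescaled families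
  `T_t(m+1)·((m₀+1)/(m+1))^{e+1}`, from Hankel boxes at the mode threshold `m₀+1`.

Elementary; standard axioms; no definitions; no RH claim.
-/

set_option autoImplicit false
-- `Summit.RiemannHypothesis.RiemannHypothesis.…` is the layout-mandated namespace (summit = problem name).
set_option linter.dupNamespace false

noncomputable section

open Finset

namespace Summit.RiemannHypothesis.RiemannHypothesis.Theorems.WeilFormatC

/-- **`hΓo` from Hankel boxes at the mode threshold `m₀+1`.**  For tag sequences `T_t` (square-summable against
`1/m²` beyond `m₀+1`) and boxes `|Σ_{k≥0} T_t(m₀+1+k)T_{t'}(m₀+1+k)((m₀+1)/(m₀+1+k))^s − Hmid t t' s| ≤ Hrad t t' s`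
(`2 ≤ s ≤ 2D`, `Hrad` symmetric in the tags): for every `N` and `u`,
`Σ_{m∈[m₀,N)} (Σ_y u_y·T_{y.1}(m+1)·((m₀+1)/(m+1))^{y.2+1})² ≤ Σ_yΣ_{y'} u_y u_{y'} Hmid(y.1,y'.1,y.2+y'.2+2)
  + Σ_y u_y² Σ_{y'} Hrad(y.1,y'.1,y.2+y'.2+2)·ν_{y'}/ν_y`. -/
theorem cinf_sum_Ico_sq_le_of_hankel_boxes_succ {D m₀ : ℕ} (T : Fin 4 → ℕ → ℝ)
    (hT : ∀ t, Summable fun k : ℕ ↦ T t (m₀ + 1 + k) ^ 2 / ((m₀ + 1 + k : ℕ) : ℝ) ^ 2)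
    (Hmid Hrad : Fin 4 → Fin 4 → ℕ → ℝ)
    (hH : ∀ (t t' : Fin 4) (s : ℕ), 2 ≤ s → s ≤ 2 * D →
      |(∑' k : ℕ, T t (m₀ + 1 + k) * T t' (m₀ + 1 + k) * (((m₀ + 1 : ℕ) : ℝ) / ((m₀ + 1 + k : ℕ) : ℝ)) ^ s)
        - Hmid t t' s| ≤ Hrad t t' s)
    (hsym : ∀ t t' s, Hrad t t' s = Hrad t' t s)
    (ν : Fin 4 × Fin D → ℝ) (hν : ∀ y, 0 < ν y) (N : ℕ) (u : Fin 4 × Fin D → ℝ) :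
    ∑ m ∈ Finset.Ico m₀ N,
        (∑ y, u y * (T y.1 (m + 1) * (((m₀ + 1 : ℕ) : ℝ) / ((m + 1 : ℕ) : ℝ)) ^ ((y.2 : ℕ) + 1))) ^ 2
      ≤ (∑ y, ∑ y', u y * u y' * Hmid y.1 y'.1 ((y.2 : ℕ) + (y'.2 : ℕ) + 2))
        + ∑ y, u y ^ 2 * ∑ y', Hrad y.1 y'.1 ((y.2 : ℕ) + (y'.2 : ℕ) + 2) * ν y' / ν y := by
  have h := cinf_sum_Ico_sq_le_of_hankel_boxes (m₀ := m₀ + 1) (by omega) T hT Hmid Hrad hH hsym ν hν (N + 1) u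
  have e := Finset.sum_Ico_add' (fun m : ℕ ↦
      (∑ y, u y * (T y.1 m * (((m₀ + 1 : ℕ) : ℝ) / (m : ℝ)) ^ ((y.2 : ℕ) + 1))) ^ 2) m₀ N 1
  beta_reduce at e
  rw [e]
  exact h

end Summit.RiemannHypothesis.RiemannHypothesis.Theorems.WeilFormatC

end
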